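import Mathlib
import Literature.Probability.Distributions.HellySelectionTheorem
import Literature.Probability.Distributions.WeakConvergenceCDF
import HarnessLib

/-!
# Pólya's theorem: weak convergence to a continuous distribution function is uniform
# (Durrett 2019, §3.2 Exercise 3.2.9) — the measure-level form

Topic `Probability/Distributions`; namespace `Literature.Probability.Distributions`.  THEOREMS ONLY:
everything is PROVED; no definition, no named fact, no axiom.  `F_n ⇒ F` is weak convergence of
`ProbabilityMeasure ℝ` (Mathlib's topology); distribution functions are Mathlib's
`ProbabilityTheory.cdf`; uniform convergence is Mathlib's `TendstoUniformly`.

Source, VERBATIM [cite: Durrett2019, §3.2 Exercise 3.2.9, p. 127 of the held copy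
`book:durrett2019-probability-theory-examples` (PDF p0139)]:
"**3.2.9** If `F_n ⇒ F` and `F` is continuous, then `sup_x |F_n(x) − F(x)| → 0`."

FORMALIZATION AND ROUTE.  The deterministic statement of the exercise — nondecreasing
`F_n : ℝ → [0,1]` converging at every point to a continuous distribution function `F` converge
uniformly — is ALREADY the tree's `Durrett2019_ex_3_2_9` (`HellySelectionTheorem.lean`, the grid
argument).  This file only adds the measure-level reading: for probability measures `μ_n → μ`
weakly on `ℝ` with `cdf μ` continuous, `cdf μ_n → cdf μ` uniformly (`TendstoUniformly`), the
pointwise convergence at every point being the tree's `WeakConvergenceCDF.tendsto_cdf_of_tendsto`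
(every point is a continuity point) and the limits `cdf μ → 0, 1` at `∓∞` Mathlib's
`tendsto_cdf_atBot/atTop`; `_eps` is the printed `sup_x |F_n(x) − F(x)| → 0` in `ε`-form.
(v2 of this file: v1 re-proved the deterministic core as
`tendstoUniformly_of_forall_tendsto_of_monotone`; it is dropped in favour of the tree's
`Durrett2019_ex_3_2_9`, which nothing else referenced.)

## References
* R. Durrett, *Probability: Theory and Examples*, 5th ed. (CUP 2019), §3.2 Exercise 3.2.9
  (p. 127). [cite: Durrett2019]
-/

noncomputable section

open _root_.MeasureTheory _root_.ProbabilityTheory Filter Set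
open scoped Topology ENNReal NNReal

namespace Literature.Probability.Distributions

/-- **Durrett, Exercise 3.2.9 (Pólya's theorem):** "If `F_n ⇒ F` and `F` is continuous, then
`sup_x |F_n(x) − F(x)| → 0`" — `cdf μ_n → cdf μ` uniformly on `ℝ` (from the tree's deterministic
`Durrett2019_ex_3_2_9` and `WeakConvergenceCDF.tendsto_cdf_of_tendsto`).
[cite: Durrett2019, §3.2 Exercise 3.2.9] -/
theorem Durrett2019_exercise_3_2_9 {μs : ℕ → ProbabilityMeasure ℝ} {μ : ProbabilityMeasure ℝ}
    (hμ : Tendsto μs atTop (𝓝 μ)) (hF : Continuous (cdf (μ : Measure ℝ))) :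
    TendstoUniformly (fun n => (cdf (μs n : Measure ℝ) : ℝ → ℝ)) (cdf (μ : Measure ℝ)) atTop := by
  have h := Durrett2019_ex_3_2_9 (F := cdf (μ : Measure ℝ))
    (Fn := fun n => (cdf (μs n : Measure ℝ) : ℝ → ℝ)) (fun n => monotone_cdf _)
    (fun n x => ⟨cdf_nonneg _ _, cdf_le_one _ _⟩) hF (tendsto_cdf_atBot _) (tendsto_cdf_atTop _)
    fun x => WeakConvergenceCDF.tendsto_cdf_of_tendsto hμ hF.continuousAt
  rw [Metric.tendstoUniformly_iff]
  intro ε hε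
  filter_upwards [h (ε / 2) (half_pos hε)] with n hn x
  rw [Real.dist_eq, abs_sub_comm]
  exact lt_of_le_of_lt (hn x) (half_lt_self hε)

/-- **Durrett, Exercise 3.2.9**, `ε`-form: for every `ε > 0`, eventually `|F_n(x) − F(x)| < ε` for
all `x`. [cite: Durrett2019, §3.2 Exercise 3.2.9] -/
theorem Durrett2019_exercise_3_2_9_eps {μs : ℕ → ProbabilityMeasure ℝ} {μ : ProbabilityMeasure ℝ}
    (hμ : Tendsto μs atTop (𝓝 μ)) (hF : Continuous (cdf (μ : Measure ℝ))) {ε : ℝ} (hε : 0 < ε) :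
    ∀ᶠ n in atTop, ∀ x : ℝ, |cdf (μs n : Measure ℝ) x - cdf (μ : Measure ℝ) x| < ε := by
  have h := Metric.tendstoUniformly_iff.1 (Durrett2019_exercise_3_2_9 hμ hF) ε hε
  filter_upwards [h] with n hn x
  rw [abs_sub_comm, ← Real.dist_eq]
  exact hn x

end Literature.Probability.Distributions
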